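import Literature.Analysis.FluidPDE.BiotSavartCurlPair
import Literature.Analysis.FluidPDE.NewtonPotentialGradient
import Literature.Analysis.FluidPDE.DivCurlLiouvilleBounded
import HarnessLib

/-!
# Discharge of `biotSavart_curl_eq_self`: an `L²`-type field on `ℝ³` is the Biot–Savart velocity
of its curl

Analysis/FluidPDE file **discharging** the named fact `Literature.Analysis.FluidPDE.biotSavart_curl_eq_self`
(`Vorticity.lean`; Majda–Bertozzi, *Vorticity and Incompressible Flow* (CUP 2002), §2.4.1
**Prop. 2.16** with the Liouville uniqueness argument of its proof, p. 63–64 of the held text):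
a `C¹`, divergence-free velocity field `u` on `ℝ³` which vanishes at infinity and whose curl is
integrable and bounded is recovered from its curl, `u = K₃ * curl u`. This is brick **B2′** of the
discharge programme for `Literature.Analysis.FluidPDE.MajdaBertozzi2002_holderEulerUniqueness`
(`ElgindiAprioriBlowupProofs.lean`: in the Hölder class of the Elgindi–Ghoul–Masmoudi blow-up
theorem every slice is the Biot–Savart velocity of its vorticity).

## Proof (`biotSavart_curl_eq_self_holds`)

Let `ω = curl u` (continuous, `L¹ ∩ L^∞`) and `w = u − K₃ * ω`. Then

* `w` is continuous and tends to `0` at infinity (`continuous_biotSavart`,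
  `tendsto_biotSavart_cocompact`, `BiotSavartIntegral.lean`);
* `w` is weakly divergence free: `∫ ⟪u, ∇θ⟫ = 0` (the tree's `IsDivFree.isWeaklyDivFree_holds`)
  and `∫ ⟪K₃ * ω, ∇θ⟫ = ∫ ⟪ω, K₃ * ∇θ⟫ = 0` (symmetry, `integral_inner_biotSavart_eq`, and
  `K₃ * ∇θ = 0`, `biotSavart_gradient_eq_zero`, `BiotSavartNewtonKernel.lean`);
* `w` annihilates the curl-type fields `(∂ₐg) c − (∂_c g) a`: both `u` and `K₃ * ω` pair with them
  to `∫ g ⟪ω, c × a⟫` (`integral_inner_curlPair_eq_integral_inner_curl_smul`,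
  `integral_inner_biotSavart_curlPair_eq`, `BiotSavartCurlPair.lean`, the correction term vanishing
  by `IsWeaklyDivFree.integral_inner_integral_fderiv_newtonKernel_smul_gradient_eq_zero`,
  `NewtonPotentialGradient.lean`, since `curl u` is weakly divergence free, `isWeaklyDivFree_curl`);

hence `w = 0` by the bounded `div`–`curl` Liouville theorem
(`IsWeaklyDivFree.eq_zero_of_tendsto_cocompact_of_forall_integral_inner_curlPair_eq_zero`,
`DivCurlLiouvilleBounded.lean`). Majda–Bertozzi run the same argument for smooth rapidly decaying
`ω` ("the difference … is harmonic … vanishes", proof of Prop. 2.16); the fact as vendored asks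
only `ω ∈ L¹ ∩ L^∞`, `u → 0` at infinity, which is what the proof uses.

## References

* A. J. Majda, A. L. Bertozzi, *Vorticity and Incompressible Flow* (CUP 2002), §2.4.1
  Prop. 2.16 and its proof, (2.90)–(2.97) (p. 63–64 of the held text). [MajdaBertozziCUP2002]
-/

noncomputable section

open MeasureTheory Set Filter Topology Function Metric InnerProductSpace
open scoped ENNReal NNReal RealInnerProductSpace

namespace Literature.Analysis.FluidPDE

/-- **Discharge of `biotSavart_curl_eq_self`** (Majda–Bertozzi, Prop. 2.16: Biot–Savart
representation of a divergence-free field by its curl, with the Liouville uniqueness argument;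
see the module docstring for the proof). [cite: MajdaBertozziCUP2002, §2.4.1 Prop. 2.16 (p. 63–64 of the held text)] -/
theorem biotSavart_curl_eq_self_holds : biotSavart_curl_eq_self := by
  intro u hu hdiv hdecay hint hbdd
  obtain ⟨C, hC⟩ := hbdd
  have hωc : Continuous (curl u) := continuous_curl hu
  have hBSc : Continuous (biotSavart (curl u)) := continuous_biotSavart hωc hint hC
  set w : EuclideanSpace ℝ (Fin 3) → EuclideanSpace ℝ (Fin 3) :=
    fun x => u x - biotSavart (curl u) x with hw
  -- it suffices to show `w = 0`
  suffices hw0 : w = 0 by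
    funext x
    have hx := congrFun hw0 x
    simp only [hw, Pi.zero_apply, sub_eq_zero] at hx
    exact hx.symm
  have hwc : Continuous w := hu.continuous.sub hBSc
  have hw0 : Tendsto w (cocompact (EuclideanSpace ℝ (Fin 3))) (𝓝 0) := by
    simpa using hdecay.sub (tendsto_biotSavart_cocompact hωc hint hC)
  -- weak divergence-freeness
  have hdivw : IsWeaklyDivFree w := by
    intro θ hθ
    have hθ2 : ContDiff ℝ 2 θ := contDiff_infty.1 hθ.contDiff 2
    have hg : Continuous (gradient θ) :=
      FluidPDE.continuous_gradient_of_contDiff (contDiff_infty.1 hθ.contDiff 1)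
    have hgc : HasCompactSupport (gradient θ) :=
      (hθ.hasCompactSupport.fderiv (𝕜 := ℝ)).comp_left
        (g := (InnerProductSpace.toDual ℝ (EuclideanSpace ℝ (Fin 3))).symm) (map_zero _)
    have i1 := integrable_inner_of_hasCompactSupport_right hu.continuous hg hgc
    have i2 := integrable_inner_of_hasCompactSupport_right hBSc hg hgc
    have e : ∀ x, ⟪w x, gradient θ x⟫ = ⟪u x, gradient θ x⟫ - ⟪biotSavart (curl u) x, gradient θ x⟫ :=
      fun x => inner_sub_left _ _ _
    simp_rw [e]
    rw [integral_sub i1 i2, VectorCalculus.IsDivFree.isWeaklyDivFree_holds hdiv hu θ hθ,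
      integral_inner_biotSavart_eq hωc hint hC hg hgc, biotSavart_gradient_eq_zero hθ2
        hθ.hasCompactSupport]
    simp
  -- annihilation of the curl-type fields
  have hcurl : ∀ g : EuclideanSpace ℝ (Fin 3) → ℝ,
      FunctionSpaces.IsTestFunctionOn (⊤ : TopologicalSpace.Opens (EuclideanSpace ℝ (Fin 3))) g →
      ∀ a c : EuclideanSpace ℝ (Fin 3),
        ∫ x, ⟪w x, fderiv ℝ g x a • c - fderiv ℝ g x c • a⟫ = 0 := by
    intro g hg a c
    have hg1 : ContDiff ℝ 1 g := contDiff_infty.1 hg.contDiff 1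
    have hΦ : Continuous fun x => fderiv ℝ g x a • c - fderiv ℝ g x c • a :=
      (((hg1.continuous_fderiv one_ne_zero).clm_apply continuous_const).smul continuous_const).sub
        (((hg1.continuous_fderiv one_ne_zero).clm_apply continuous_const).smul continuous_const)
    have hΦc : HasCompactSupport fun x => fderiv ℝ g x a • c - fderiv ℝ g x c • a :=
      ((hg.hasCompactSupport.fderiv_apply (𝕜 := ℝ) a).smul_right).sub
        ((hg.hasCompactSupport.fderiv_apply (𝕜 := ℝ) c).smul_right)
    have i1 := integrable_inner_of_hasCompactSupport_right hu.continuous hΦ hΦc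
    have i2 := integrable_inner_of_hasCompactSupport_right hBSc hΦ hΦc
    have e : ∀ x, ⟪w x, fderiv ℝ g x a • c - fderiv ℝ g x c • a⟫ =
        ⟪u x, fderiv ℝ g x a • c - fderiv ℝ g x c • a⟫ -
          ⟪biotSavart (curl u) x, fderiv ℝ g x a • c - fderiv ℝ g x c • a⟫ :=
      fun x => inner_sub_left _ _ _
    simp_rw [e]
    rw [integral_sub i1 i2, integral_inner_curlPair_eq_integral_inner_curl_smul hu hg1
        hg.hasCompactSupport a c,
      integral_inner_biotSavart_curlPair_eq hωc hint hC hg.contDiff hg.hasCompactSupport a c,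
      (isWeaklyDivFree_curl hu).integral_inner_integral_fderiv_newtonKernel_smul_gradient_eq_zero
        hint hg.contDiff hg.hasCompactSupport (cross c a)]
    ring
  exact hdivw.eq_zero_of_tendsto_cocompact_of_forall_integral_inner_curlPair_eq_zero hwc hw0 hcurl

end Literature.Analysis.FluidPDE
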